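import Literature.NumberTheory.LFunctions.ConreyIwaniec2002Proofs
import Literature.NumberTheory.LFunctions.ConreyIwaniec2002PropTenOneWeak
import HarnessLib

/-!
# Conrey–Iwaniec (2002), §1 read through the `(log q)^{7/2}` principal estimate: Theorem 1.1 with
# `(log q)^{−(2A+7)}`, its specialisation `(log q)^{−67}`, and Corollary 1.3 with `(log q)^{−19}`

Conrey–Iwaniec, Acta Arith. 103 (2002) 259–312 [held text `paper:arxiv-math_0111012`], §1
(Theorem 1.1 (1.20)–(1.21), the remark "Taking `A = 12` …", Corollary 1.3) and §10 (Proposition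
10.1, the Remark after Corollary 10.2).

WHY THIS FILE. The tree types Theorem 1.1 AS PRINTED as the named fact
`conreyIwaniec2002_theorem11` (exponent `−(2A+6)`, no parity restriction on `q`; audited, NOT
re-worded here) and proves its odd-`q` case from the typed Proposition 10.1
(`conreyIwaniec2002_theorem11_odd_of_proposition101`). The printed derivation of Proposition 10.1
passes through Proposition 9.2, whose printed deduction from Proposition 9.1 uses the cosmetic
claim of (9.11) (`|L′(1,χ)| ≪ log q` in the exceptional regime — not located in print, OPEN; see
`ConreyIwaniec2002PrincipalEstimate.lean`, Friedlander–Iwaniec 2018 (4.1) for the state of the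
art). What the typed Proposition 9.1 yields WITHOUT that claim is the principal estimate with
`(log q)^{7/2}` (`conreyIwaniec2002_proposition92_weak_of_proposition91`) and hence Proposition
10.1 with `(log q)^{−(2A+7)}` (`conreyIwaniec2002_proposition101_weak_of_proposition91`, file
`ConreyIwaniec2002PropTenOneWeak.lean`). This file runs the printed §1 deductions on that weak
Proposition 10.1 — every step is exponent-transparent, so each exponent moves by exactly one power
of `log q`:

* `conreyIwaniec2002_theorem11_weak` — **Theorem 1.1 with `(log T)^{−2}(log q)^{−(2A+7)}`**, in the
  scope `q` odd of the printed proof (§7). A `def`, so that consumers (the `ψ = 1` doors, route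
  items) can bind the form supported by the located inputs BY NAME, as they bind
  `conreyIwaniec2002_theorem11` today. It is a SUPERSESSION, not a correction: the audited
  statement implies it (`conreyIwaniec2002_theorem11_weak_of_theorem11`), and it is DERIVED here
  from the typed Proposition 9.1 alone (`conreyIwaniec2002_theorem11_weak_of_proposition91`, via
  `ConreyIwaniec2002.theorem11_weak_of_proposition101_weak` = the tree's §10-Remark proof
  `conreyIwaniec2002_theorem11_odd_of_proposition101` re-run verbatim on the weak hypothesis).
* `lOne_ge_log_pow_neg_67_of_theorem11_weak` — the printed specialisation "`A = 12`,
  `log T = (log q)^{18}`" now reads `L(1,χ) ≥ (log q)^{−67}` (printed: `−66`; tree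
  `lOne_ge_log_pow_neg_66_of_theorem11`).
* `ConreyIwaniec2002.corollary13_odd_weak_of_proposition101_weak`,
  `conreyIwaniec2002_corollary13_odd_weak_of_proposition91` — Corollary 1.3 for odd `q` with
  `(log q)^{−19}` (printed: `−18`; tree `conreyIwaniec2002_corollary13_odd_of_proposition101`),
  `A = 0`, `α = 1`, `s′_r = s_r`, `log T = (log q)^6`.

Exponent map (plan-1 ROWS-ADDENDUM-A2 §A2.4; findings register F-S3/CI-(9.11)): Thm 1.1
`2A+6 ↦ 2A+7`; `66 ↦ 67`; Cor 1.3 `18 ↦ 19`; the `ψ = 1` Dedekind door `4A+18 ↦ 4A+19`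
(`DedekindCloseZeroHypothesisWeak.lean`); Corollary 10.2 / Theorem 1.2 (`(log q)^{−90}`) UNCHANGED
(`ConreyIwaniec2002CorTenTwoWeak.lean`). Everything here is PROVED except the one `def`; no new
named fact is introduced (the `def` is discharged modulo the typed Proposition 9.1). NOT
RH-BEARING; no claim about exceptional characters or about the actual spacing of zeros; no
Landau–Siegel statement is proved by this file.

## References

* [ConreyIwaniec2002] B. Conrey, H. Iwaniec, Acta Arith. 103 (2002) 259–312, arXiv:math/0111012:
  Theorem 1.1 (1.20)–(1.21) and the remark after it; Corollary 1.3; Proposition 10.1; the Remark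
  closing §10.
* [FriedlanderIwaniec2018] J. Friedlander, H. Iwaniec, Expo. Math. 36 (2018), arXiv:1701.03771
  (status of the bound behind (9.11)) — context only, cited by no declaration.
-/

noncomputable section

open scoped NumberField
open Complex Set

namespace Literature.NumberTheory.LFunctions

open ConreyIwaniec2002 NumberField

/-! ### Theorem 1.1, weak exponent -/

/-- **Conrey–Iwaniec 2002, Theorem 1.1 with exponent `2A+7` (scope: `q` odd).** "Let `A ≥ 0` and
`log T ≥ (log q)^{A+6}`. Suppose `D(α,T) ≥ c T log T / (α (log q)^A)` (1.20) for some `0 < α ≤ 1`,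
where `c` is a large absolute constant. Then `L(1,χ) ≥ (log T)^{−2} (log q)^{−2A−6}` (1.21)" —
here with the conclusion WEAKENED to `(log T)^{−2}(log q)^{−2A−7}` and §7's standing "`q` odd" made
explicit: this is the form of Theorem 1.1 that the typed Proposition 9.1 delivers through the
`(log q)^{7/2}` principal estimate (the printed `−2A−6` needs the unlocated claim of (9.11)).
Data as in `conreyIwaniec2002_theorem11`: `K = ℚ(√−q)`, `−q` fundamental, `q > 4`, `χ = (−q/·)`
odd primitive quadratic, `ψ ∈ Ĉℓ(K)`, `D(α,T) = closeZeroCount (L(·,ψ)) α T`; ONE absolute `c > 0`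
outermost. The audited `conreyIwaniec2002_theorem11` implies it
(`conreyIwaniec2002_theorem11_weak_of_theorem11`); it is proved from the typed Proposition 9.1
(`conreyIwaniec2002_theorem11_weak_of_proposition91`). A statement (`Prop`), never asserted.
[cite: ConreyIwaniec2002, Theorem 1.1] -/
def conreyIwaniec2002_theorem11_weak : Prop :=
  ∃ c : ℝ, 0 < c ∧
    ∀ A : ℝ, 0 ≤ A →
      ∀ (q : ℕ) [NeZero q], 4 < q → Odd q → ∀ χ : DirichletCharacter ℂ q,
        χ.IsPrimitive → χ.IsQuadratic → χ.Odd →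
          ∀ (K : Type) [Field K] [NumberField K],
            Module.finrank ℚ K = 2 → NumberField.discr K = -(q : ℤ) →
              ∀ (ψ : ClassGroup (𝓞 K) →* ℂˣ) (T α : ℝ), 2 ≤ T → 0 < α → α ≤ 1 →
                Real.log q ^ (A + 6) ≤ Real.log T →
                  c * T * Real.log T / (α * Real.log q ^ A) ≤
                      (closeZeroCount (classGroupLFunction K ψ) α T : ℝ) →
                    Real.log T ^ (-(2 : ℝ)) * Real.log q ^ (-(2 * A + 7)) ≤ ‖χ.LFunction 1‖

/-- **The printed Theorem 1.1 implies the weak form** (same absolute `c`;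
`(log q)^{−(2A+7)} ≤ (log q)^{−(2A+6)}` because `log q > 1` for `q ≥ 5`). Sanity link showing the
supersession is a weakening. [cite: ConreyIwaniec2002, Theorem 1.1] -/
theorem conreyIwaniec2002_theorem11_weak_of_theorem11 (h : conreyIwaniec2002_theorem11) :
    conreyIwaniec2002_theorem11_weak := by
  obtain ⟨c, hc, h⟩ := h
  refine ⟨c, hc, fun A hA q _ hq _ χ hprim hquad hodd K _ _ h2 hdisc ψ T α hT hα hα1 hlogT hD => ?_⟩
  have hq5 : (5 : ℝ) ≤ q := by exact_mod_cast hq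
  have hℓ1 : 1 < Real.log q := by
    rw [Real.lt_log_iff_exp_lt (by linarith)]
    exact Real.exp_one_lt_d9.trans_le (by linarith)
  have key := h A hA q hq χ hprim hquad hodd K h2 hdisc ψ T α hT hα hα1 hlogT hD
  refine le_trans ?_ key
  have hT0 : 0 ≤ Real.log T ^ (-(2 : ℝ)) := Real.rpow_nonneg (Real.log_nonneg (by linarith)) _
  exact mul_le_mul_of_nonneg_left
    (Real.rpow_le_rpow_of_exponent_le hℓ1.le (by linarith)) hT0

/-- **Theorem 1.1 (weak exponent, odd `q`) follows from the WEAK Proposition 10.1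
(`(log q)^{−(2A+7)}`)** — the §10 Remark ("If the points of `S(T)` are zeros of `L(s)` then the
condition that they are spaced by at least one can be dropped at the expense of extra factor
`log T` in (10.12) … Hence we derive Theorem 1.1"), formally the tree's
`conreyIwaniec2002_theorem11_odd_of_proposition101` VERBATIM (Jensen count `≤ 128 log T` ordinates
per unit window, `card_filter_round_eq_le_classGroup`; well-spaced subselection
`exists_separated_subset`; companions among the zeros of `L(s,ψ)`, divided difference `0`;
constant of (1.20) `= 256 c`): the argument never touches the exponent of `log q` in the
conclusion, so the weak (10.13) gives the weak (1.21).
[cite: ConreyIwaniec2002, Theorem 1.1 (proof: §10, Remark)] -/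
theorem ConreyIwaniec2002.theorem11_weak_of_proposition101_weak
    (h : ∃ c : ℝ, 0 < c ∧
    ∀ A : ℝ, 0 ≤ A →
      ∀ (q : ℕ) [NeZero q], 4 < q → Odd q → ∀ χ : DirichletCharacter ℂ q,
        χ.IsPrimitive → χ.IsQuadratic → χ.Odd →
          ∀ (K : Type) [Field K] [NumberField K],
            Module.finrank ℚ K = 2 → NumberField.discr K = -(q : ℤ) →
              ∀ (ψ : ClassGroup (𝓞 K) →* ℂˣ) (T α : ℝ) (S : Finset ℝ) (t' : ℝ → ℝ),
                2 ≤ T → 0 < α → α ≤ 1 → Real.log q ^ (A + 6) ≤ Real.log T →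
                  IsPointSet S T →
                    (∀ t ∈ S, |t - t' t| ≤ gapRadius α t) →
                      (∀ t ∈ S, ‖dividedDifference (classGroupLFunction K ψ)
                          (1 / 2 + t * I) (1 / 2 + t' t * I)‖ ≤ Real.log q ^ ((7 : ℝ) / 2)) →
                        c * T / (α * Real.log q ^ A) ≤ (S.card : ℝ) →
                          Real.log T ^ (-(2 : ℝ)) * Real.log q ^ (-(2 * A + 7)) ≤
                            ‖χ.LFunction 1‖) :
    conreyIwaniec2002_theorem11_weak := by
  classical
  obtain ⟨c₀, hc₀, hP⟩ := h
  refine ⟨256 * c₀, by positivity,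
    fun A hA q _ hq hoddq χ hprim hquad hodd K _ _ h2 hdisc ψ T α hT2 hα0 hα1 hlogTq hD => ?_⟩
  have hq5 : (5 : ℝ) ≤ q := by exact_mod_cast hq
  have hℓ1 : 1 < Real.log q := by
    rw [Real.lt_log_iff_exp_lt (by linarith)]
    exact Real.exp_one_lt_d9.trans_le (by linarith)
  have hℓ0 : 0 < Real.log q := by linarith
  have hT0 : 0 < T := by linarith
  have hℓT : Real.log q ≤ Real.log T :=
    calc Real.log q = Real.log q ^ (1 : ℝ) := (Real.rpow_one _).symm
      _ ≤ Real.log q ^ (A + 6) := Real.rpow_le_rpow_of_exponent_le hℓ1.le (by linarith)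
      _ ≤ Real.log T := hlogTq
  have hLT1 : 1 ≤ Real.log T := by linarith
  have hLT0 : 0 < Real.log T := by linarith
  set L : ℂ → ℂ := classGroupLFunction K ψ with hLdef
  -- the counted set is finite and large
  have hden : 0 < α * Real.log q ^ A := mul_pos hα0 (Real.rpow_pos_of_pos hℓ0 _)
  have hDpos : (0 : ℝ) < closeZeroCount L α T :=
    lt_of_lt_of_le (div_pos (by positivity) hden) hD
  have hfin : (closeZeroOrdinates L α T).Finite := by
    refine Set.finite_of_ncard_ne_zero ?_
    have h1 : (0 : ℝ) < ((closeZeroOrdinates L α T).ncard : ℝ) := hDpos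
    exact_mod_cast h1.ne'
  set Z : Finset ℝ := hfin.toFinset with hZdef
  have hZcard : (closeZeroCount L α T : ℝ) = Z.card := by
    rw [closeZeroCount, hZdef, Set.ncard_eq_toFinset_card _ hfin]
  have hZ : ∀ γ ∈ Z, 2 ≤ γ ∧ γ ≤ T ∧ HasCloseZero L (gapRadius α γ) γ := by
    intro γ hγ
    rw [hZdef, Set.Finite.mem_toFinset] at hγ
    exact hγ
  have hZ' : ∀ γ ∈ Z, 0 < γ ∧ γ ≤ T ∧ classGroupLFunction K ψ (1 / 2 + γ * I) = 0 :=
    fun γ hγ => ⟨by linarith [(hZ γ hγ).1], (hZ γ hγ).2.1, (hZ γ hγ).2.2.1⟩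
  -- `≤ 128 log T` ordinates per unit window, then the well-spaced subselection
  have hdq : (NumberField.discr K).natAbs = q := by rw [hdisc]; simp
  have hdT : Real.log ((NumberField.discr K).natAbs : ℝ) ≤ Real.log T := by
    rw [hdq]; exact hℓT
  have hfib : ∀ k : ℤ, ((Z.filter (fun γ => round γ = k)).card : ℝ) ≤ 128 * Real.log T :=
    card_filter_round_eq_le_classGroup ψ hT0 hLT1 h2 hdT Z hZ'
  obtain ⟨S, hSZ, hSsep, hScard⟩ := exists_separated_subset Z hfib
  -- companions: the close zero, or the point itself at a multiple zero
  have hcomp : ∀ γ : ℝ, ∃ γ' : ℝ, HasCloseZero L (gapRadius α γ) γ →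
      (γ' = γ ∧ deriv L (1 / 2 + γ * I) = 0) ∨
        (γ' ≠ γ ∧ L (1 / 2 + γ' * I) = 0 ∧ |γ - γ'| ≤ gapRadius α γ) := by
    intro γ
    by_cases hex : ∃ γ' : ℝ, γ' ≠ γ ∧ L (1 / 2 + γ' * I) = 0 ∧ |γ - γ'| ≤ gapRadius α γ
    · obtain ⟨γ', hγ'⟩ := hex
      exact ⟨γ', fun _ => Or.inr hγ'⟩
    · exact ⟨γ, fun hγ => Or.inl ⟨rfl, hγ.2.resolve_right hex⟩⟩
  choose t' ht' using hcomp
  have hS : IsPointSet S T :=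
    ⟨fun t ht => ⟨(hZ t (hSZ ht)).1, (hZ t (hSZ ht)).2.1⟩, hSsep⟩
  have h10 : ∀ t ∈ S, |t - t' t| ≤ gapRadius α t := by
    intro t ht
    obtain ⟨ht2, -, hclose⟩ := hZ t (hSZ ht)
    rcases ht' t hclose with ⟨heq, -⟩ | ⟨-, -, hr⟩
    · rw [heq, sub_self, abs_zero]
      unfold gapRadius
      exact div_nonneg (mul_nonneg Real.pi_pos.le (by linarith))
        (Real.log_pos (by linarith)).le
    · exact hr
  have h11 : ∀ t ∈ S, ‖dividedDifference (classGroupLFunction K ψ) (1 / 2 + t * I)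
      (1 / 2 + t' t * I)‖ ≤ Real.log q ^ ((7 : ℝ) / 2) := by
    intro t ht
    obtain ⟨-, -, hclose⟩ := hZ t (hSZ ht)
    suffices h0 : dividedDifference L (1 / 2 + t * I) (1 / 2 + t' t * I) = 0 by
      rw [← hLdef, h0, norm_zero]; exact Real.rpow_nonneg hℓ0.le _
    rcases ht' t hclose with ⟨heq, hder⟩ | ⟨hne, hz', -⟩
    · rw [heq, dividedDifference_self, hder]
    · have hne' : (1 / 2 + t' t * I : ℂ) ≠ 1 / 2 + t * I := by
        intro he
        apply hne
        have him := congrArg Complex.im he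
        simpa using him
      exact dividedDifference_eq_zero_of_zeros _ hne' hclose.1 hz'
  have h12 : c₀ * T / (α * Real.log q ^ A) ≤ (S.card : ℝ) := by
    have h1 : 256 * c₀ * T * Real.log T / (α * Real.log q ^ A) ≤
        2 * (128 * Real.log T) * S.card := by
      calc 256 * c₀ * T * Real.log T / (α * Real.log q ^ A) ≤ Z.card := by rw [← hZcard]; exact hD
        _ ≤ _ := hScard
    rw [div_le_iff₀ hden] at h1 ⊢
    have h2' : Real.log T * (c₀ * T) ≤ Real.log T * (S.card * (α * Real.log q ^ A)) := by
      nlinarith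
    exact le_of_mul_le_mul_left h2' hLT0
  exact hP A hA q hq hoddq χ hprim hquad hodd K h2 hdisc ψ T α S t' hT2 hα0 hα1 hlogTq hS h10
    h11 h12

/-- **Theorem 1.1 with exponent `2A+7` (odd `q`) from the typed Proposition 9.1 ALONE** — no
(9.11)-claim, no Siegel-type input: Prop 9.1 ⟹ (9.12) with `(log q)^{7/2}` ⟹ Prop 10.1 with
`(log q)^{−(2A+7)}` ⟹ this. [cite: ConreyIwaniec2002, Theorem 1.1] -/
theorem conreyIwaniec2002_theorem11_weak_of_proposition91 (h91 : conreyIwaniec2002_proposition91) :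
    conreyIwaniec2002_theorem11_weak :=
  theorem11_weak_of_proposition101_weak (conreyIwaniec2002_proposition101_weak_of_proposition91 h91)

/-! ### The printed specialisation `A = 12`, `log T = (log q)^{18}`: exponent `67` -/

/-- **"Taking `A = 12` and `log T = (log q)^{18}` we get `L(1,χ) ≥ (log q)^{−66}`, provided
`D(α,T) ≥ α^{−1} c T (log T)^{1/3}`"** — run on the weak Theorem 1.1 the same arithmetic gives
`L(1,χ) ≥ (log q)^{−67}` (`(log T)^{−2}(log q)^{−31} = (log q)^{−36−31}`), with the SAME absolute
`c` and for odd `q`; tree `lOne_ge_log_pow_neg_66_of_theorem11` verbatim with `30 ↦ 31`.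
Modulo `conreyIwaniec2002_theorem11_weak`. [cite: ConreyIwaniec2002, Theorem 1.1 (p. 2, after (1.21))] -/
theorem lOne_ge_log_pow_neg_67_of_theorem11_weak (h : conreyIwaniec2002_theorem11_weak) :
    ∃ c : ℝ, 0 < c ∧
      ∀ (q : ℕ) [NeZero q], 4 < q → Odd q → ∀ χ : DirichletCharacter ℂ q,
        χ.IsPrimitive → χ.IsQuadratic → χ.Odd →
          ∀ (K : Type) [Field K] [NumberField K],
            Module.finrank ℚ K = 2 → NumberField.discr K = -(q : ℤ) →
              ∀ (ψ : ClassGroup (𝓞 K) →* ℂˣ) (T α : ℝ), 2 ≤ T → 0 < α → α ≤ 1 →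
                Real.log T = Real.log q ^ (18 : ℝ) →
                  α⁻¹ * c * T * Real.log T ^ ((1 : ℝ) / 3) ≤
                      (closeZeroCount (classGroupLFunction K ψ) α T : ℝ) →
                    Real.log q ^ (-(67 : ℝ)) ≤ ‖χ.LFunction 1‖ := by
  obtain ⟨c, hc, h⟩ := h
  refine ⟨c, hc, fun q _ hq hoddq χ hprim hquad hodd K _ _ h2 hdisc ψ T α hT hα hα1 hlogT hD => ?_⟩
  have hq1 : (1 : ℝ) < q := by exact_mod_cast (show 1 < q by omega)
  have hlq : 0 < Real.log q := Real.log_pos hq1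
  have h12 := h 12 (by norm_num) q hq hoddq χ hprim hquad hodd K h2 hdisc ψ T α hT hα hα1
  -- `(log q)^{12+6} = (log q)^{18} = log T`
  have hpow : Real.log q ^ ((12 : ℝ) + 6) = Real.log T := by rw [hlogT]; norm_num
  -- `(log T)^{1/3} = (log q)^6`
  have hthird : Real.log T ^ ((1 : ℝ) / 3) = Real.log q ^ (6 : ℝ) := by
    rw [hlogT, ← Real.rpow_mul hlq.le]; norm_num
  -- the hypothesis (1.20) with `A = 12` is the printed proviso
  have hhyp : c * T * Real.log T / (α * Real.log q ^ (12 : ℝ)) ≤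
      (closeZeroCount (classGroupLFunction K ψ) α T : ℝ) := by
    have hq12 : 0 < Real.log q ^ (12 : ℝ) := Real.rpow_pos_of_pos hlq _
    have key : c * T * Real.log T / (α * Real.log q ^ (12 : ℝ)) =
        α⁻¹ * c * T * Real.log T ^ ((1 : ℝ) / 3) := by
      rw [hthird, hlogT, show (18 : ℝ) = 6 + 12 by norm_num, Real.rpow_add hlq]
      field_simp
    rw [key]; exact hD
  have hconc := h12 hpow.le hhyp
  -- `(log T)^{-2} (log q)^{-31} = (log q)^{-67}`
  have hval : Real.log T ^ (-(2 : ℝ)) * Real.log q ^ (-(2 * 12 + 7 : ℝ)) =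
      Real.log q ^ (-(67 : ℝ)) := by
    rw [hlogT, ← Real.rpow_mul hlq.le, ← Real.rpow_add hlq]; norm_num
  rw [← hval]
  exact hconc

/-! ### Corollary 1.3 (odd `q`), weak exponent `19` -/

/-- **Corollary 1.3, for odd `q`, from the WEAK Proposition 10.1** ("the following assertion
follows immediately from Proposition 10.1": companions `s′_r = s_r`, `α = 1`, `A = 0`,
`log T = (log q)^6`; the implied constant of "`R ≫ T`" is the absolute `c` of (10.12) and the weak
(10.13) reads `L(1,χ) ≥ (log T)^{−2}(log q)^{−7} = (log q)^{−19}` with constant `1`; printed: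
`(log q)^{−18}`). Tree `conreyIwaniec2002_corollary13_odd_of_proposition101` verbatim with `6 ↦ 7`.
[cite: ConreyIwaniec2002, Corollary 1.3] -/
theorem ConreyIwaniec2002.corollary13_odd_weak_of_proposition101_weak
    (h : ∃ c : ℝ, 0 < c ∧
    ∀ A : ℝ, 0 ≤ A →
      ∀ (q : ℕ) [NeZero q], 4 < q → Odd q → ∀ χ : DirichletCharacter ℂ q,
        χ.IsPrimitive → χ.IsQuadratic → χ.Odd →
          ∀ (K : Type) [Field K] [NumberField K],
            Module.finrank ℚ K = 2 → NumberField.discr K = -(q : ℤ) →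
              ∀ (ψ : ClassGroup (𝓞 K) →* ℂˣ) (T α : ℝ) (S : Finset ℝ) (t' : ℝ → ℝ),
                2 ≤ T → 0 < α → α ≤ 1 → Real.log q ^ (A + 6) ≤ Real.log T →
                  IsPointSet S T →
                    (∀ t ∈ S, |t - t' t| ≤ gapRadius α t) →
                      (∀ t ∈ S, ‖dividedDifference (classGroupLFunction K ψ)
                          (1 / 2 + t * I) (1 / 2 + t' t * I)‖ ≤ Real.log q ^ ((7 : ℝ) / 2)) →
                        c * T / (α * Real.log q ^ A) ≤ (S.card : ℝ) →
                          Real.log T ^ (-(2 : ℝ)) * Real.log q ^ (-(2 * A + 7)) ≤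
                            ‖χ.LFunction 1‖) :
    ∃ c₁ : ℝ, 0 < c₁ ∧ ∃ c' : ℝ, 0 < c' ∧
      ∀ (q : ℕ) [NeZero q], 4 < q → Odd q → ∀ χ : DirichletCharacter ℂ q,
        χ.IsPrimitive → χ.IsQuadratic → χ.Odd →
          ∀ (K : Type) [Field K] [NumberField K],
            Module.finrank ℚ K = 2 → NumberField.discr K = -(q : ℤ) →
              ∀ (ψ : ClassGroup (𝓞 K) →* ℂˣ) (S : Finset ℝ),
                IsPointSet S (Real.exp (Real.log q ^ (6 : ℕ))) →
                  (∀ t ∈ S, ‖deriv (classGroupLFunction K ψ) (1 / 2 + t * I)‖ ≤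
                      Real.log q ^ ((7 : ℝ) / 2)) →
                    c₁ * Real.exp (Real.log q ^ (6 : ℕ)) ≤ (S.card : ℝ) →
                      c' * Real.log q ^ (-(19 : ℝ)) ≤ ‖χ.LFunction 1‖ := by
  obtain ⟨c₀, hc₀, hP⟩ := h
  refine ⟨c₀, hc₀, 1, one_pos,
    fun q _ hq hoddq χ hprim hquad hodd K _ _ h2 hdisc ψ S hS hder hR => ?_⟩
  have hq5 : (5 : ℝ) ≤ q := by exact_mod_cast hq
  have hℓ1 : 1 < Real.log q := by
    rw [Real.lt_log_iff_exp_lt (by linarith)]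
    exact Real.exp_one_lt_d9.trans_le (by linarith)
  have hℓ0 : 0 < Real.log q := by linarith
  set T : ℝ := Real.exp (Real.log q ^ (6 : ℕ)) with hTdef
  have hlogT : Real.log T = Real.log q ^ (6 : ℕ) := Real.log_exp _
  have h6 : 1 < Real.log q ^ (6 : ℕ) := one_lt_pow₀ hℓ1 (by norm_num)
  have hT2 : (2 : ℝ) ≤ T := by
    have h1 := Real.add_one_le_exp (Real.log q ^ (6 : ℕ))
    linarith
  have hlogTq : Real.log q ^ ((0 : ℝ) + 6) ≤ Real.log T := by
    rw [hlogT, show ((0 : ℝ) + 6) = ((6 : ℕ) : ℝ) by norm_num, Real.rpow_natCast]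
  have h10 : ∀ t ∈ S, |t - (fun u : ℝ => u) t| ≤ gapRadius 1 t := by
    intro t _
    simp [gapRadius]
  have h11 : ∀ t ∈ S, ‖dividedDifference (classGroupLFunction K ψ) (1 / 2 + t * I)
      (1 / 2 + (fun u : ℝ => u) t * I)‖ ≤ Real.log q ^ ((7 : ℝ) / 2) := by
    intro t ht
    rw [show (fun u : ℝ => u) t = t from rfl, dividedDifference_self]
    exact hder t ht
  have h12 : c₀ * T / (1 * Real.log q ^ (0 : ℝ)) ≤ (S.card : ℝ) := by
    rw [Real.rpow_zero, one_mul, div_one]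
    exact hR
  have hres := hP 0 le_rfl q hq hoddq χ hprim hquad hodd K h2 hdisc ψ T 1 S (fun u : ℝ => u)
    hT2 one_pos le_rfl hlogTq hS h10 h11 h12
  have hval : Real.log T ^ (-(2 : ℝ)) * Real.log q ^ (-(2 * 0 + 7) : ℝ) =
      Real.log q ^ (-(19 : ℝ)) := by
    rw [hlogT, ← Real.rpow_natCast (Real.log q) 6, ← Real.rpow_mul hℓ0.le, ← Real.rpow_add hℓ0]
    norm_num
  rw [one_mul, ← hval]
  exact hres

/-- **Corollary 1.3 with `(log q)^{−19}` (odd `q`) from the typed Proposition 9.1 ALONE.**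
[cite: ConreyIwaniec2002, Corollary 1.3] -/
theorem conreyIwaniec2002_corollary13_odd_weak_of_proposition91
    (h91 : conreyIwaniec2002_proposition91) :
    ∃ c₁ : ℝ, 0 < c₁ ∧ ∃ c' : ℝ, 0 < c' ∧
      ∀ (q : ℕ) [NeZero q], 4 < q → Odd q → ∀ χ : DirichletCharacter ℂ q,
        χ.IsPrimitive → χ.IsQuadratic → χ.Odd →
          ∀ (K : Type) [Field K] [NumberField K],
            Module.finrank ℚ K = 2 → NumberField.discr K = -(q : ℤ) →
              ∀ (ψ : ClassGroup (𝓞 K) →* ℂˣ) (S : Finset ℝ),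
                IsPointSet S (Real.exp (Real.log q ^ (6 : ℕ))) →
                  (∀ t ∈ S, ‖deriv (classGroupLFunction K ψ) (1 / 2 + t * I)‖ ≤
                      Real.log q ^ ((7 : ℝ) / 2)) →
                    c₁ * Real.exp (Real.log q ^ (6 : ℕ)) ≤ (S.card : ℝ) →
                      c' * Real.log q ^ (-(19 : ℝ)) ≤ ‖χ.LFunction 1‖ :=
  corollary13_odd_weak_of_proposition101_weak
    (conreyIwaniec2002_proposition101_weak_of_proposition91 h91)

end Literature.NumberTheory.LFunctions

end
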